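import Summits.Ventures.GridStability.Models.DroopVoltageBox
import Summits.Ventures.GridStability.Models.WSCC9DroopQVLinearisation

/-!
# GridStability/Models/WSCC9DroopQVVoltageBox — rider: an invariant voltage box for «DROOPQV-WSCC9» (model-8's G3.b instance), exact

Cell `gridfusion` (LADDER-GRIDFUSION, apex line G3.b; seat gridfusion-model-3 (g7)). Instance reading of
`Models/DroopVoltageBox.lean` §3 (`DroopMicrogrid.voltage_wbox_invariant`, p528866/p529531) on model-8's
CONSTRUCTION instance «DROOPQV-WSCC9» (`WSCC9.droopQV : DroopQVData 2`, `Models/WSCC9DroopQVLinearisation.lean`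
p519344: `τ_Q = 1/2`, `k_Q = 1/5`, `V* = E`, `G = 0`, `B = B_dqv` = `WSCC9.B_postB` off the diagonal and the
TRUE self-susceptances `Bdiag_dqv ≈ (−2.2288, −1.9526, −2.3423)` on it; set-points `Q^set = Q(θ*, V*)` by
construction, kernel-bridged to `droopQV.QsetQ` by `DroopQVData.Qset_eq`).

DATUM (why the weighted form): plain row dominance FAILS at node 2 (`Σ_{j≠2}|B_2j| ≈ 1.9557 > −B_22 ≈ 1.9526`),
while the weight `w = (1, 51/50, 1)` passes all three rows (`droopQV_dominance`, exact: `norm_num`).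
With `b_i = V*_i + k_Q Q_i^set ≈ (1.2209, 1.1033, 1.0377)` and `λ = 5/4` (`λ w = (1.25, 1.275, 1.25) > b`,
`droopQV_faces`): **every solution of the full droop+QV model (4a)–(4c) of «DROOPQV-WSCC9» whose voltages
start in `[0, 5/4] × [0, 51/40] × [0, 5/4]` keeps them there for all times, whatever the angles and
frequencies do** (`droopQV_voltage_box`; the operating point `V* ≈ (1.057, 1.050, 1.017)` lies inside); §2 lifts the
lower face to `ℓ = 1/2` (`droopQV_voltage_band`: the band `[1/2, 5/4] × [1/2, 51/40] × [1/2, 5/4]` is invariant).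

THREE COLUMNS. CERTIFIED: the invariance (std axioms). MODELLED: SYNTHETIC/CONSTRUCTION instance (model-8's
module doc: WSCC9 h12 network + KunduEtAl2019 §V gains, MV-6N); an invariant box — not an attractor, not
voltage-regulation quality, nothing about a device. VALIDATED: nothing. Data custody: model-4 Row DQ
(`B_dqv`, `E`, circle points by name); the only new numerals here are `w = (1, 51/50, 1)` and `λ = 5/4`.
-/

noncomputable section

open Real Set Finset

namespace Summit.Ventures.GridStability.Models.WSCC9

/-- The weight vector of the box: `w = (1, 51/50, 1)`. -/
def vboxW : Fin 3 → ℚ := ![1, 51 / 50, 1]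

/-- Weighted susceptance dominance of «DROOPQV-WSCC9» with `w = (1, 51/50, 1)` (exact; `G = 0`):
`Σ_{j≠i} (|G_ij| + |B_ij|) w_j ≤ −B_ii w_i` for `i = 1, 2, 3`. -/
theorem droopQV_dominance (i : Fin 3) :
    ∑ j ∈ univ.erase i, (|droopQV.G i j| + |droopQV.B i j|) * vboxW j ≤ -droopQV.B i i * vboxW i := by
  rw [Finset.sum_erase_eq_sub (mem_univ i), Fin.sum_univ_three]
  fin_cases i <;>
    simp [droopQV, B_dqv, Bdiag_dqv, B_postB, vboxW] <;> norm_num [abs_of_pos, abs_of_neg]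

/-- The two face data, exact: `0 < b_i = V*_i + k_Q Q_i^set < (5/4) w_i` for every node
(`Q^set` through the kernel-friendly `QsetQ`). -/
theorem droopQV_faces (i : Fin 3) :
    0 < droopQV.V i + droopQV.kQ i * droopQV.QsetQ i ∧
      droopQV.V i + droopQV.kQ i * droopQV.QsetQ i < 5 / 4 * vboxW i := by
  fin_cases i <;> constructor <;> decide +kernel

/-- **Rider: invariant voltage box of «DROOPQV-WSCC9».** Along every solution of the full droop+QV model
`droopQV.toMicrogrid` (KunduEtAl2019 (4a)–(4c) at the instance data) on `[0, T]` with
`0 ≤ V₁(0) ≤ 5/4`, `0 ≤ V₂(0) ≤ 51/40`, `0 ≤ V₃(0) ≤ 5/4`: the same bounds hold for all `t ∈ [0, T]`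
— angles and frequencies arbitrary. MODELLED: construction instance (see module doc). -/
theorem droopQV_voltage_box {T : ℝ} {γ : ℝ → DroopMicrogrid.State 3}
    (h : droopQV.toMicrogrid.IsSolutionOn γ (Icc 0 T))
    (h0 : ∀ i, 0 ≤ (γ 0).2.2 i ∧ (γ 0).2.2 i ≤ 5 / 4 * (vboxW i : ℝ)) :
    ∀ t ∈ Icc 0 T, ∀ i, 0 ≤ (γ t).2.2 i ∧ (γ t).2.2 i ≤ 5 / 4 * (vboxW i : ℝ) := by
  have hτ : ∀ i, 0 < droopQV.toMicrogrid.τQ i := by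
    intro i; show (0:ℝ) < ((droopQV.τQ i : ℚ) : ℝ); simp [droopQV]
  have hkQ : ∀ i, 0 ≤ droopQV.toMicrogrid.kQ i := by
    intro i; show (0:ℝ) ≤ ((droopQV.kQ i : ℚ) : ℝ); norm_num [droopQV]
  have hQset : ∀ i, droopQV.toMicrogrid.Qset i = (droopQV.QsetQ i : ℝ) :=
    fun i => droopQV.Qset_eq droopQV_circle i
  have hbval : ∀ i, droopQV.toMicrogrid.Vset i + droopQV.toMicrogrid.kQ i * droopQV.toMicrogrid.Qset i
      = (droopQV.V i : ℝ) + (droopQV.kQ i : ℝ) * (droopQV.QsetQ i : ℝ) := by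
    intro i
    rw [hQset i]
    rfl
  have hb : ∀ i, 0 < droopQV.toMicrogrid.Vset i + droopQV.toMicrogrid.kQ i * droopQV.toMicrogrid.Qset i := by
    intro i
    have h' := (Rat.cast_lt (K := ℝ)).2 (droopQV_faces i).1
    push_cast at h'
    rw [hbval i]; exact h'
  have hw : ∀ i : Fin 3, (0 : ℝ) < (vboxW i : ℝ) := by
    intro i; fin_cases i <;> simp [vboxW]
  have hdom : ∀ i, ∑ j ∈ univ.erase i,
      (|droopQV.toMicrogrid.G i j| + |droopQV.toMicrogrid.B i j|) * (vboxW j : ℝ)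
        ≤ -droopQV.toMicrogrid.B i i * (vboxW i : ℝ) := by
    intro i
    have hq := (Rat.cast_le (K := ℝ)).2 (droopQV_dominance i)
    push_cast at hq
    exact hq
  have hlam : ∀ i, droopQV.toMicrogrid.Vset i + droopQV.toMicrogrid.kQ i * droopQV.toMicrogrid.Qset i
      < 5 / 4 * (vboxW i : ℝ) := by
    intro i
    have h' := (Rat.cast_lt (K := ℝ)).2 (droopQV_faces i).2
    push_cast at h'
    rw [hbval i]; exact h'
  exact droopQV.toMicrogrid.voltage_wbox_invariant hτ hkQ hb hw hdom hlam h h0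

/-! ## §2 The two-sided band: voltages of «DROOPQV-WSCC9» never drop below `1/2` -/

/-- `Q^set` of the instance, exact (kernel evaluation of `QsetQ`; floats ≈ 0.8217, 0.2654, 0.1037). -/
theorem droopQV_QsetQ :
    droopQV.QsetQ 0 = 5536706628385809864412498106563 / 6738302164864273613000000000000 ∧
    droopQV.QsetQ 1 = 447112334769537926074364047703 / 1684575541216068403250000000000 ∧
    droopQV.QsetQ 2 = 27953680440611156138169612539 / 269532086594570944520000000000 := by
  refine ⟨?_, ?_, ?_⟩ <;> decide +kernel

/-- Lower-face data at `ℓ = 1/2`, exact: `ℓ + k_Q ℓ (−B_ii ℓ + (5/4) Σ_{j≠i} (|G_ij| + |B_ij|) w_j) < b_i`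
for every node (≈ 0.839 / 0.842 / 0.909 against `b ≈ 1.221 / 1.103 / 1.038`). -/
theorem droopQV_lower_faces (i : Fin 3) :
    (1 / 2 : ℚ) + droopQV.kQ i * (1 / 2) *
        (-droopQV.B i i * (1 / 2) + 5 / 4 * ∑ j ∈ univ.erase i, (|droopQV.G i j| + |droopQV.B i j|) * vboxW j)
      < droopQV.V i + droopQV.kQ i * droopQV.QsetQ i := by
  rw [Finset.sum_erase_eq_sub (mem_univ i), Fin.sum_univ_three]
  fin_cases i <;> decide +kernel

/-- **Rider: two-sided voltage band of «DROOPQV-WSCC9».** Along every solution of the full droop+QV model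
`droopQV.toMicrogrid` on `[0, T]` with `1/2 ≤ V₁(0) ≤ 5/4`, `1/2 ≤ V₂(0) ≤ 51/40`, `1/2 ≤ V₃(0) ≤ 5/4`:
the same two-sided bounds hold for all `t ∈ [0, T]` — the voltage magnitudes of the MODEL stay in
`[0.5, 1.275]` whatever the angles and frequencies do (`DroopMicrogrid.voltage_band_invariant`).
MODELLED: construction instance; a band, not regulation quality or stability. -/
theorem droopQV_voltage_band {T : ℝ} {γ : ℝ → DroopMicrogrid.State 3}
    (h : droopQV.toMicrogrid.IsSolutionOn γ (Icc 0 T))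
    (h0 : ∀ i, (1 / 2 : ℝ) ≤ (γ 0).2.2 i ∧ (γ 0).2.2 i ≤ 5 / 4 * (vboxW i : ℝ)) :
    ∀ t ∈ Icc 0 T, ∀ i, (1 / 2 : ℝ) ≤ (γ t).2.2 i ∧ (γ t).2.2 i ≤ 5 / 4 * (vboxW i : ℝ) := by
  have hτ : ∀ i, 0 < droopQV.toMicrogrid.τQ i := by
    intro i; show (0:ℝ) < ((droopQV.τQ i : ℚ) : ℝ); simp [droopQV]
  have hkQ : ∀ i, 0 ≤ droopQV.toMicrogrid.kQ i := by
    intro i; show (0:ℝ) ≤ ((droopQV.kQ i : ℚ) : ℝ); norm_num [droopQV]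
  have hQset : ∀ i, droopQV.toMicrogrid.Qset i = (droopQV.QsetQ i : ℝ) :=
    fun i => droopQV.Qset_eq droopQV_circle i
  have hbval : ∀ i, droopQV.toMicrogrid.Vset i + droopQV.toMicrogrid.kQ i * droopQV.toMicrogrid.Qset i
      = (droopQV.V i : ℝ) + (droopQV.kQ i : ℝ) * (droopQV.QsetQ i : ℝ) := by
    intro i; rw [hQset i]; rfl
  have hw : ∀ i : Fin 3, (0 : ℝ) < (vboxW i : ℝ) := by
    intro i; fin_cases i <;> simp [vboxW]
  have hdom : ∀ i, ∑ j ∈ univ.erase i,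
      (|droopQV.toMicrogrid.G i j| + |droopQV.toMicrogrid.B i j|) * (vboxW j : ℝ)
        ≤ -droopQV.toMicrogrid.B i i * (vboxW i : ℝ) := by
    intro i
    have hq := (Rat.cast_le (K := ℝ)).2 (droopQV_dominance i)
    push_cast at hq
    exact hq
  have hlam : ∀ i, droopQV.toMicrogrid.Vset i + droopQV.toMicrogrid.kQ i * droopQV.toMicrogrid.Qset i
      < 5 / 4 * (vboxW i : ℝ) := by
    intro i
    have h' := (Rat.cast_lt (K := ℝ)).2 (droopQV_faces i).2
    push_cast at h'
    rw [hbval i]; exact h'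
  have hℓ : ∀ i, (fun _ : Fin 3 => (1 / 2 : ℝ)) i + droopQV.toMicrogrid.kQ i * (fun _ : Fin 3 => (1 / 2 : ℝ)) i *
      (-droopQV.toMicrogrid.B i i * (fun _ : Fin 3 => (1 / 2 : ℝ)) i
        + 5 / 4 * ∑ j ∈ univ.erase i,
          (|droopQV.toMicrogrid.G i j| + |droopQV.toMicrogrid.B i j|) * (vboxW j : ℝ))
      < droopQV.toMicrogrid.Vset i + droopQV.toMicrogrid.kQ i * droopQV.toMicrogrid.Qset i := by
    intro i
    have h' := (Rat.cast_lt (K := ℝ)).2 (droopQV_lower_faces i)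
    push_cast at h'
    rw [hbval i]; exact h'
  exact droopQV.toMicrogrid.voltage_band_invariant hτ hkQ hw hdom hlam (ℓ := fun _ => (1 / 2 : ℝ))
    (fun _ => by norm_num) hℓ h h0

end Summit.Ventures.GridStability.Models.WSCC9

end
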